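import Mathlib
import HarnessLib
import Literature.MathematicalPhysics.StatisticalMechanics.FluctuationDefect
import Literature.MathematicalPhysics.StatisticalMechanics.FluctuationOfHamiltonian
import Literature.MathematicalPhysics.StatisticalMechanics.LinearisedMap

/-!
# The exact first-order cancellation at a single block ([ABKM19] Theorem 6.8: `D_H S(0,0) = 0`, `D_K S(0,0) = C_k`)

In the reblocked renormalisation map `S(H,K)(U)` (`GradientRG.nextKStep_eq_sum` /
`RenormalisationMapSplit.nextKStep_eq_split`, `PolymerProductSplit.polyP2_eq_add_add_rest`) the terms of
degree `≤ 1` in `(H,K)` attached to a single `k`-block `B ⊆ U` are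
`p_B · [(1 − e^{−H̃(B)}) + R(e^{−H(B)} − 1) + R K(B)]`, `p_B = (e^{−H̃})^{U∖B}`, with `H̃ = A_kH + B_kK`
(`FluctuationOfHamiltonian.nextH_eq`).  The choice of `H̃` makes their first order equal to the
single-block part `R K(B) + u_B`, `u_B = (B_kK)(B) = −Π₂RK(B)`, of the linearisation `C_k K`
(`LinearisedMap.blockTerm`): writing `a = A_kH(B)`, `u = u_B`, `r = R e^{−H(B)}`, `κ = R K(B)`,
`p[(1−e^{−(a+u)}) + (r−1) + κ] − (κ + u) = (p−1)(κ+u) + p[(r − e^{−a}) + (e^{−a}−1)(1−e^{−u}) − (e^{−u}−1+u)]`,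
and every bracket on the right is of second order: `p − 1` (a product of `e^{−H̃(B')}` minus one),
`r − e^{−a} = D_B(H)` (`FluctuationDefect`), `(e^{−a}−1)(1−e^{−u})`, `e^{−u}−1+u`.  This is the
"exact first-order cancellation" of the crux line's CH12-PLAN §5.

* `block_cancellation_ring` — the identity in `ℂ`;
* **`firstOrder_block_identity`** — the identity for the tree's objects
  (`nextH`, `fluct`, `expNegH`, `blockTerm`, `fluctDefect`, `opB`, `stepOpA (gradCov 𝒞)`).

Everything is proved; no named fact.

## References
* S. Adams, S. Buchholz, R. Kotecký, S. Müller, arXiv:1910.13564, Theorem 6.8 ((6.55)–(6.64)),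
  Ch. 9.1, Lemma 10.1 [AdamsBuchholzKoteckyMuller2019].
-/

noncomputable section

namespace Literature.MathematicalPhysics.StatisticalMechanics.GradientRG

open scoped BigOperators Classical
open Finset MeasureTheory

variable {d M : ℕ} [NeZero M]

omit [NeZero M] in
/-- The cancellation identity in `ℂ`: with `e^{−(a+u)} = e^{−a}e^{−u}`,
`p[(1−e^{−(a+u)}) + (r−1) + κ] − (κ+u) = (p−1)(κ+u) + p[(r−e^{−a}) + (e^{−a}−1)(1−e^{−u}) − (e^{−u}−1+u)]`.
[cite: AdamsBuchholzKoteckyMuller2019, Theorem 6.8 ((6.61)–(6.64))] -/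
theorem block_cancellation_ring (p r κ a u : ℂ) :
    p * ((1 - Complex.exp (-(a + u))) + (r - 1) + κ) - (κ + u) =
      (p - 1) * (κ + u) +
        p * ((r - Complex.exp (-a)) + (Complex.exp (-a) - 1) * (1 - Complex.exp (-u)) -
          (Complex.exp (-u) - 1 + u)) := by
  rw [neg_add, Complex.exp_add]
  ring

/-- **The exact first-order cancellation at a block** for the concrete step `T_k`: with
`H̃ = nextH D H K = A_kH + B_kK` (hypotheses of `nextH_eq`: `circulant 𝒞 ⪰ 0`, `B₀ ≠ ∅`, room for the
test polynomials), `u = (B_kK)(B,φ) = eval (opB D K) B φ`, `a = (A_kH)(B,φ)`, any prefactor `p ∈ ℂ`, and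
`e^{−H(B, φ+·)}` integrable for `μ_{k+1}`:
`p·[(1 − e^{−H̃(B,φ)}) + R(e^{−H(B)}−1)(φ) + RK(B)(φ)] − blockTerm(B,φ)
  = (p−1)·blockTerm(B,φ) + p·[D_B(H)(φ) + (e^{−a}−1)(1−e^{−u}) − (e^{−u}−1+u)]`,
where `blockTerm D K B φ = RK(B)(φ) + u` is the single-block piece of `C_kK` and `D_B(H) = fluctDefect`.
[cite: AdamsBuchholzKoteckyMuller2019, Theorem 6.8 ((6.55)–(6.64)) / Ch. 9.1] -/
theorem firstOrder_block_identity (D : StepData d M) (hC : (Matrix.circulant D.𝒞).PosSemidef)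
    (hB₀ : D.B₀.card ≠ 0) (hroom : ∀ x ∈ D.B₀, HasRoom D.c₀ x (d / 2 + 1))
    (H : RelevantHamiltonian ℂ d) (K : Finset (Fin d → ZMod M) → ((Fin d → ZMod M) → ℝ) → ℂ)
    (B : Finset (Fin d → ZMod M)) (φ : (Fin d → ZMod M) → ℝ) (p : ℂ)
    (hI : Integrable (fun ξ => expNegH H B (φ + ξ)) (stepMeasure D.𝒞)) :
    p * ((1 - expNegH (nextH D H K) B φ) + fluct D.𝒞 (fun ψ => expNegH H B ψ - 1) φ +
        fluct D.𝒞 (K B) φ) - blockTerm D K B φ =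
      (p - 1) * blockTerm D K B φ +
        p * (fluctDefect D.𝒞 H B φ +
          (expNegH (stepOpA (gradCov D.𝒞) H) B φ - 1) * (1 - Complex.exp (-(eval (opB D K) B φ))) -
          (Complex.exp (-(eval (opB D K) B φ)) - 1 + eval (opB D K) B φ)) := by
  haveI := isProbabilityMeasure_stepMeasure D.𝒞
  -- `H̃(B) = a + u`
  have hHt : eval (nextH D H K) B φ = eval (stepOpA (gradCov D.𝒞) H) B φ + eval (opB D K) B φ := by
    rw [nextH_eq D hC hB₀ hroom H K, eval_add]
  -- `R(e^{−H(B)} − 1) = R e^{−H(B)} − 1`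
  have hR1 : fluct D.𝒞 (fun ψ => expNegH H B ψ - 1) φ = fluct D.𝒞 (expNegH H B) φ - 1 := by
    unfold fluct
    rw [integral_sub hI (integrable_const _)]
    simp
  rw [hR1]
  unfold expNegH fluctDefect blockTerm
  rw [hHt]
  unfold expNegH
  exact block_cancellation_ring p _ _ _ _

end Literature.MathematicalPhysics.StatisticalMechanics.GradientRG

end
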